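import Summits.ABC.ABC.Theorems.TwistAmplificationSharpModerateLawReduction
import Summits.ABC.ABC.Theorems.TwistAmplificationSharpModerateLawFewDeepFlat6
import Literature.NumberTheory.CubicFields.UniformityEstimateHolds

/-!
# Crux `TwistAmplification.SharpModerateLaw` (stmt-ABC-1975): discharge of the uniformity stub and the
unconditional residue of the census lines

Lead `prover-line-stmt-ABC-1975-c4-0` (line `unit-plane-conic-two-torsion`, skeleton v4), 2026-08-16.

The named Literature fact `btt_uniformity_sqDvd` (Bhargava–Taniguchi–Thorne 2023, Prop. 4.5: for squarefree `q`
the cubic rings with `q² ∣ Disc` and `0 < ±Disc < X` number `O(6^{ω(q)} X/q²)`) is a THEOREM of the tree since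
2026-08-16 19:56Z (`Literature.NumberTheory.CubicFields.btt_uniformity_sqDvd_holds`). It was the registered stub
`stub_uniformity` of BOTH census lines of this crux (`syzygy-lattice-half-deep-few-primes`, skeleton v7;
`unit-plane-conic-two-torsion`, skeletons v2–v3.1). This file banks the consequences, all compositions over landed files:

* §1 `stub_uniformity` (the stub, by its registered name and signature), `fieldSum_holds`, `fewDeepLaw_holds`,
  `fewDeepLawCone_holds`, `UnitPlane.lawWithConeE_fewDeepFlat6_holds` — the "few deep primes" half of the census
  programme is now UNCONDITIONAL (Kane's lattice half + the field sum, `…Reduction.lean`, `…FewDeepFlat6.lean`);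
* §2 the syzygy line's reduction made unconditional: `sharpModerateLaw_of_spreadLawCone : SpreadLawCone → SharpModerateLaw`
  (was `btt_uniformity_sqDvd → SpreadLawCone → SharpModerateLaw`, p78128), with the two-parameter variants;
* §3 the RESIDUE THEOREM: with the few-deep law proved, the open cores of the two census lines are EQUIVALENT to each other
  and to the full cone index-form shell law —
  `SpreadLawCone ↔ IndexFormShellLawCone ↔ (LawWithConeE SpreadDeep6 1 ∧ RingCensus6 ∧ CornerHallLaw6)`;
  in particular the unit-plane v3/v4 split (conic census / ring census / Hall corner) is a PARTITION of the one common open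
  core, and each of its three open stubs is implied by `SpreadLawCone`.
-/

noncomputable section

-- the mandated summit namespace `Summit.ABC.ABC` (summit = problem) trips the duplicate-namespace linter
set_option linter.dupNamespace false

namespace Summit.ABC.ABC.Theorems.SharpModerateLaw

open Literature.NumberTheory.CubicFields

/-! ## 1. The uniformity stub and the few-deep half, unconditionally -/

/-- **`stub_uniformity`** (registered stub of both census lines, DISCHARGED): the Bhargava–Taniguchi–Thorne
uniformity estimate `btt_uniformity_sqDvd`, by the tree theorem `btt_uniformity_sqDvd_holds`. -/
theorem stub_uniformity : Literature.NumberTheory.CubicFields.btt_uniformity_sqDvd :=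
  btt_uniformity_sqDvd_holds

/-- **The field sum holds**: `Σ_{0<|D|≤N} h_max(D)/rad(D) ≤ C_ε N^ε` (landed `stub_fieldSum` fed with the proved
uniformity estimate). -/
theorem fieldSum_holds : FieldSum :=
  stub_fieldSum stub_uniformity

/-- **The few-deep-primes law holds** unconditionally: `totalCount FewDeep X Y ≤ C_ε (XY)^ε · X·Y^{-1/6}` for all
`X, Y ≥ 1` (Kane's lattice half + the field sum; landed `fewDeepLaw_of_uniformity`). -/
theorem fewDeepLaw_holds : FewDeepLaw :=
  fewDeepLaw_of_uniformity stub_uniformity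

/-- The cone-restricted few-deep law holds unconditionally. -/
theorem fewDeepLawCone_holds : FewDeepLawCone :=
  fewDeepLawCone_of_fewDeepLaw fewDeepLaw_holds

/-! ## 2. The syzygy line's reduction, unconditionally -/

/-- **The crux reduced to its open core, unconditionally**: the cone-restricted spread law for index forms of maximal
cubic rings implies `SharpModerateLaw` (the syzygy line's `sharpModerateLaw_of_uniformity_of_spreadLawCone`, p78128, with
its only named-fact hypothesis discharged). -/
theorem sharpModerateLaw_of_spreadLawCone :
    SpreadLawCone → Summit.ABC.ABC.Theses.TwistAmplification.SharpModerateLaw :=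
  sharpModerateLaw_of_uniformity_of_spreadLawCone stub_uniformity

/-- The same with the unrestricted two-parameter spread law. -/
theorem sharpModerateLaw_of_spreadLaw :
    SpreadLaw → Summit.ABC.ABC.Theses.TwistAmplification.SharpModerateLaw :=
  sharpModerateLaw_of_uniformity_of_spreadLaw stub_uniformity

/-- The full two-parameter cusp shell law from the unrestricted spread law alone. -/
theorem cuspShellLaw_of_spreadLaw : SpreadLaw → CuspShellLaw :=
  cuspShellLaw_of_uniformity_of_spreadLaw stub_uniformity

/-! ## 3. The residue theorem: one open core for both census lines -/

/-- `SpreadLawCone → IndexFormShellLawCone` (cone split with the proved few-deep law). -/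
theorem indexFormShellLawCone_of_spreadLawCone (h : SpreadLawCone) : IndexFormShellLawCone :=
  indexFormShellLawCone_of_split fewDeepLawCone_holds h

/-- A cone law for the whole shell gives the cone law (additive constant `1`) for any sub-population
(the ε-free case of the landed `UnitPlane.lawWithConeE_of_indexFormShellLawCone`). -/
theorem lawWithCone_of_indexFormShellLawCone (P : ℝ → ℝ → BinaryCubic ℤ → ℤ × ℤ → Prop)
    (h : IndexFormShellLawCone) : LawWithCone P 1 :=
  UnitPlane.lawWithConeE_of_indexFormShellLawCone (fun _ => P) h

/-- `IndexFormShellLawCone → SpreadLawCone` (monotonicity in the population). -/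
theorem spreadLawCone_of_indexFormShellLawCone (h : IndexFormShellLawCone) : SpreadLawCone :=
  lawWithCone_of_indexFormShellLawCone _ h

/-- **The syzygy line's open core IS the cone index-form shell law**: `SpreadLawCone ↔ IndexFormShellLawCone`. -/
theorem spreadLawCone_iff_indexFormShellLawCone : SpreadLawCone ↔ IndexFormShellLawCone :=
  ⟨indexFormShellLawCone_of_spreadLawCone, spreadLawCone_of_indexFormShellLawCone⟩

namespace UnitPlane

/-- **The v3 few-deep law holds** unconditionally: `LawWithConeE FewDeepFlat6 0` (landed `stub_fewDeepFlat6` fed with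
`fewDeepLaw_holds`). -/
theorem lawWithConeE_fewDeepFlat6_holds : LawWithConeE FewDeepFlat6 0 :=
  stub_fewDeepFlat6 fewDeepLaw_holds

/-- The three open unit-plane stubs (spread-deep law, ring census, Hall corner) give the cone index-form shell law
(`flat6Cover_glue` with the proved v3 few-deep law). -/
theorem indexFormShellLawCone_of_residue (hD : LawWithConeE SpreadDeep6 1) (hR : RingCensus6) (hH : CornerHallLaw6) :
    IndexFormShellLawCone :=
  flat6Cover_glue lawWithConeE_fewDeepFlat6_holds hD hR hH

/-- **The crux from the three open unit-plane stubs alone** (uniformity, the v3 few-deep law, the uniform lever and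
Heath-Brown's conic bound all being theorems): spread-deep law → ring census → Hall corner → `SharpModerateLaw`. -/
theorem sharpModerateLaw_of_residue (hD : LawWithConeE SpreadDeep6 1) (hR : RingCensus6) (hH : CornerHallLaw6) :
    Summit.ABC.ABC.Theses.TwistAmplification.SharpModerateLaw :=
  cuspTransferCone (syzygyTransferCone (indexFormShellLawCone_of_residue hD hR hH))

/-- The cone index-form shell law gives each of the three open unit-plane stubs. -/
theorem residue_of_indexFormShellLawCone (h : IndexFormShellLawCone) :
    LawWithConeE SpreadDeep6 1 ∧ RingCensus6 ∧ CornerHallLaw6 :=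
  ⟨lawWithConeE_of_indexFormShellLawCone _ h, lawWithConeE_of_indexFormShellLawCone _ h,
    lawWithConeE_of_indexFormShellLawCone _ h⟩

/-- **Residue theorem (unit-plane form)**: the conjunction of the three open stubs of the line is EQUIVALENT to the cone
index-form shell law. -/
theorem residue_iff_indexFormShellLawCone :
    (LawWithConeE SpreadDeep6 1 ∧ RingCensus6 ∧ CornerHallLaw6) ↔ IndexFormShellLawCone :=
  ⟨fun h => indexFormShellLawCone_of_residue h.1 h.2.1 h.2.2, residue_of_indexFormShellLawCone⟩

/-- **Residue theorem (cross-line form)**: the unit-plane residue is EQUIVALENT to the syzygy line's open core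
`SpreadLawCone` — both census lines have one and the same open core. -/
theorem residue_iff_spreadLawCone :
    (LawWithConeE SpreadDeep6 1 ∧ RingCensus6 ∧ CornerHallLaw6) ↔ SpreadLawCone :=
  residue_iff_indexFormShellLawCone.trans spreadLawCone_iff_indexFormShellLawCone.symm

/-- Each open unit-plane stub is implied by the syzygy line's open core: spread-deep law. -/
theorem spreadDeep6Law_of_spreadLawCone (h : SpreadLawCone) : LawWithConeE SpreadDeep6 1 :=
  (residue_iff_spreadLawCone.mpr h).1

/-- Each open unit-plane stub is implied by the syzygy line's open core: ring census. -/
theorem ringCensus6_of_spreadLawCone (h : SpreadLawCone) : RingCensus6 :=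
  (residue_iff_spreadLawCone.mpr h).2.1

/-- Each open unit-plane stub is implied by the syzygy line's open core: Hall corner. -/
theorem cornerHallLaw6_of_spreadLawCone (h : SpreadLawCone) : CornerHallLaw6 :=
  (residue_iff_spreadLawCone.mpr h).2.2

end UnitPlane

end Summit.ABC.ABC.Theorems.SharpModerateLaw

end
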